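import Literature.Computation.FiniteGraph.SAWPolynomials
import Literature.Probability.RandomPlanarGeometry.SelfAvoidingWalkProofs
import HarnessLib

/-!
# Finite-graph witness engine, VII: `SAW.weight` on lattice domains is a SAW length polynomial at
# `x_c`; certified product inequalities (TP₂ / FKG shapes)

Topic `Literature/Computation/FiniteGraph`; everything proved, no facts. For a discrete domain whose
graph `discreteDomainGraph Ω δ` is `ℤ²` induced on a finite site list `S` (hypothesis
`hG : ∀ x y, (discreteDomainGraph Ω δ).Adj x y ↔ (zdGraph 2).Adj x y ∧ toPair x ∈ S ∧ toPair y ∈ S`;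
for a `LatticeDobrushin` datum `L` this is `L.adj_iff` plus `x ∈ L.S ↔ toPair x ∈ S`), the tree's
critical two-point SAW measure satisfies

* **`SAW_weight_univ_eq`**: `SAW.weight Ω δ a b univ = ofReal (peval (sawPoly S a b) x_c)` with
  `sawPoly S a b = ofNatList (sawCounts S (toPair a) (toPair b))` (part VI) and
  `x_c = SAW.criticalFugacity`; more generally `tsum_ofReal_pow_length_eq` at any fugacity `x ≥ 0`
  (a bijection between `SAW.DomainSAW Ω δ a b` and the enumerated supports);
* **`weight_mul_weight_lt_of_posCert`**: if the sign certificate of part V accepts the difference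
  polynomial `P₃P₄ − P₁P₂` on an interval `[lo, hi] ∋ x_c` then
  `Z(a₁,b₁) Z(a₂,b₂) < Z(a₃,b₃) Z(a₄,b₄)` for `Z(a,b) = SAW.weight Ω δ a b univ` — the shape of
  the circular total-positivity inequality `Z₁₃ Z₂₄ ≤ Z₁₂ Z₃₄` (route `SAWTotalPositivity`, item
  `BoundaryTP2`) and of its NEGATION, decided by one `decide +kernel` / `native_decide`;
* **`SAW_weight_avoids_eq`**, **`weight_avoids_mul_lt_of_posCert`** — the same for the events
  `avoids a b V` ("the SAW visits no site of `V`", e.g. hull avoidances; `sawPolyAvoiding`), the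
  shape of the left–right FKG inequality `w(A) w(B) ≤ w(univ) w(A ∩ B)` (route `SAWLeftRightFKG`,
  item `LeftRightFKG`) for avoidance events `A, B` (`avoids_nil`: `V = []` is `univ`);
* the interval `criticalFugacity_mem_Icc_third_half` (`x_c ∈ [1/3, 1/2]`, elementary and axiom-free; the
  sharper `x_c ∈ [200/539, 5/13]` from the tree's certified `2.6 ≤ μ ≤ 2.695` carries `native_decide`
  axioms and lives in the separate computational file `SAWSharpFugacity.lean`).

All declarations here are axiom-clean (propext / Classical.choice / Quot.sound). A walk being
determined by its support is Mathlib's `SimpleGraph.Walk.support_injective`.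

[folklore] throughout; the measure is Lawler–Schramm–Werner 2004, §3.1/§3.4.2 as rendered by the
tree's `SelfAvoidingWalk.lean`.

## References
* G. Lawler, O. Schramm, W. Werner, *On the scaling limit of planar self-avoiding walk*, 2004,
  §3.1 [LawlerSchrammWerner2004SAW].
* N. Madras, G. Slade, *The Self-Avoiding Walk*, Birkhäuser 1993, §1.1–1.2 [MadrasSlade1993].
-/

noncomputable section

namespace Literature.Computation.FiniteGraph

open MeasureTheory Literature.Probability.LatticeModels Literature.Probability.RandomPlanarGeometry
open Literature.Probability.RandomPlanarGeometry.SAW.FiniteMemory (toPair toPair_injective)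
open scoped ENNReal

/-- The SAW length polynomial of `ℤ²[S]` between two sites, as a rational coefficient list. [folklore] -/
def sawPoly (S : List (ℤ × ℤ)) (a b : Site 2) : List ℚ := ofNatList (sawCounts S (toPair a) (toPair b))

/-- `Σ ofReal (x^k)` over a list is `ofReal` of the sum (`x ≥ 0`). [folklore] -/
theorem list_sum_map_ofReal_pow {x : ℝ} (hx : 0 ≤ x) (l : List (List (ℤ × ℤ))) :
    (l.map fun s => ENNReal.ofReal (x ^ (s.length - 1))).sum =
      ENNReal.ofReal ((l.map fun s => x ^ (s.length - 1)).sum) := by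
  induction l with
  | nil => simp
  | cons s l ih =>
      simp only [List.map_cons, List.sum_cons]
      rw [ih, ENNReal.ofReal_add (pow_nonneg hx _)]
      exact List.sum_nonneg fun t ht => by
        rw [List.mem_map] at ht
        obtain ⟨m, -, rfl⟩ := ht
        exact pow_nonneg hx _

section Domain

variable {Ω : Set ℂ} {δ : ℝ} {S : List (ℤ × ℤ)}
  (hG : ∀ x y : Site 2, (discreteDomainGraph Ω δ).Adj x y ↔ (zdGraph 2).Adj x y ∧ toPair x ∈ S ∧ toPair y ∈ S)
include hG

/-- **SAWs of the domain ↔ enumerated supports**: `γ ↦ support of γ (as pairs)` is a bijection onto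
the duplicate-free list `sawSupports S b |S| a []`. [folklore] -/
theorem bijective_supportMap (a b : Site 2) :
    Function.Bijective fun γ : SAW.DomainSAW Ω δ a b =>
      (⟨γ.walk.support.map toPair, List.mem_toFinset.2 (map_support_mem_sawSupports hG b S.length γ.walk []
        γ.isPath (length_le_of_isPath hG γ.walk γ.isPath) (by simp))⟩ :
        ↥(sawSupports S (toPair b) S.length (toPair a) []).toFinset) := by
  constructor
  · intro γ γ' h
    have h1 : γ.walk.support.map toPair = γ'.walk.support.map toPair := congrArg Subtype.val h
    have h2 : γ.walk.support = γ'.walk.support := List.map_injective_iff.2 toPair_injective h1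
    have h3 : γ.walk = γ'.walk := SimpleGraph.Walk.support_injective h2
    cases γ; cases γ'
    simp only at h3
    subst h3
    rfl
  · rintro ⟨s, hs⟩
    obtain ⟨p, hp, hsupp, -⟩ := exists_walk_of_mem_sawSupports hG b S.length a [] s (List.mem_toFinset.1 hs)
    exact ⟨⟨p, hp⟩, Subtype.ext hsupp⟩

/-- **The length generating function of the SAWs of the domain** at any fugacity `x ≥ 0`:
`Σ_γ x^{|γ|} = peval (sawPoly S a b) x` (as extended nonnegative reals). [folklore] -/
theorem tsum_ofReal_pow_length_eq (a b : Site 2) {x : ℝ} (hx : 0 ≤ x) :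
    ∑' γ : SAW.DomainSAW Ω δ a b, ENNReal.ofReal (x ^ γ.length) = ENNReal.ofReal (peval (sawPoly S a b) x) := by
  classical
  set L := sawSupports S (toPair b) S.length (toPair a) [] with hL
  let e : SAW.DomainSAW Ω δ a b ≃ ↥L.toFinset := Equiv.ofBijective _ (bijective_supportMap hG a b)
  have hterm : ∀ γ : SAW.DomainSAW Ω δ a b,
      ENNReal.ofReal (x ^ γ.length) = ENNReal.ofReal (x ^ ((e γ).1.length - 1)) := by
    intro γ
    simp only [e, Equiv.ofBijective_apply, List.length_map, SimpleGraph.Walk.length_support, Nat.add_sub_cancel]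
    rfl
  calc ∑' γ : SAW.DomainSAW Ω δ a b, ENNReal.ofReal (x ^ γ.length)
      = ∑' γ : SAW.DomainSAW Ω δ a b, ENNReal.ofReal (x ^ ((e γ).1.length - 1)) := tsum_congr hterm
    _ = ∑' s : ↥L.toFinset, ENNReal.ofReal (x ^ (s.1.length - 1)) :=
        e.tsum_eq (fun s : ↥L.toFinset => ENNReal.ofReal (x ^ (s.1.length - 1)))
    _ = ∑ s ∈ L.toFinset, ENNReal.ofReal (x ^ (s.length - 1)) := by
        rw [tsum_fintype]
        exact Finset.sum_coe_sort _ (fun s : List (ℤ × ℤ) => ENNReal.ofReal (x ^ (s.length - 1)))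
    _ = (L.map fun s => ENNReal.ofReal (x ^ (s.length - 1))).sum :=
        List.sum_toFinset _ (nodup_sawSupports S (toPair b) S.length (toPair a) [])
    _ = ENNReal.ofReal (peval (sawPoly S a b) x) := by
        rw [list_sum_map_ofReal_pow hx, sawPoly, sawCounts, peval_sawHist]

/-- **The critical two-point SAW measure of a lattice domain is a length polynomial at `x_c`:**
`SAW.weight Ω δ a b univ = ofReal (peval (sawPoly S a b) x_c)`.
[cite: LawlerSchrammWerner2004SAW, §3.1 and §3.4.2] -/
theorem SAW_weight_univ_eq (a b : Site 2) :
    SAW.weight Ω δ a b Set.univ = ENNReal.ofReal (peval (sawPoly S a b) SAW.criticalFugacity) := by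
  rw [SAW.weight, Measure.sum_apply _ MeasurableSet.univ]
  simp only [Measure.smul_apply, Measure.dirac_apply_of_mem (Set.mem_univ _), smul_eq_mul, mul_one]
  exact tsum_ofReal_pow_length_eq hG a b SAW.criticalFugacity_pos_lt_one'.1.le

/-- **Certified strict product inequality** between critical two-point weights of the domain:
if the sign certificate accepts `P₃P₄ − P₁P₂` on `[lo, hi] ∋ x_c` (`Pᵢ = sawPoly S aᵢ bᵢ`) then
`Z(a₁,b₁) Z(a₂,b₂) < Z(a₃,b₃) Z(a₄,b₄)`, `Z(a,b) = SAW.weight Ω δ a b univ`. [folklore] -/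
theorem weight_mul_weight_lt_of_posCert (a₁ b₁ a₂ b₂ a₃ b₃ a₄ b₄ : Site 2) {lo hi : ℚ} {d : ℕ}
    (hlo : (lo : ℝ) ≤ SAW.criticalFugacity) (hhi : SAW.criticalFugacity ≤ hi)
    (h : posCert (psub (pmul (sawPoly S a₃ b₃) (sawPoly S a₄ b₄)) (pmul (sawPoly S a₁ b₁) (sawPoly S a₂ b₂)))
      d lo hi = true) :
    SAW.weight Ω δ a₁ b₁ Set.univ * SAW.weight Ω δ a₂ b₂ Set.univ <
      SAW.weight Ω δ a₃ b₃ Set.univ * SAW.weight Ω δ a₄ b₄ Set.univ := by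
  have hx := SAW.criticalFugacity_pos_lt_one'.1.le
  have hpos := posCert_sound h hlo hhi
  rw [peval_psub, peval_pmul, peval_pmul] at hpos
  have h1 : 0 ≤ peval (sawPoly S a₁ b₁) SAW.criticalFugacity := peval_ofNatList_nonneg _ hx
  have h2 : 0 ≤ peval (sawPoly S a₂ b₂) SAW.criticalFugacity := peval_ofNatList_nonneg _ hx
  have h3 : 0 ≤ peval (sawPoly S a₃ b₃) SAW.criticalFugacity := peval_ofNatList_nonneg _ hx
  rw [SAW_weight_univ_eq hG, SAW_weight_univ_eq hG, SAW_weight_univ_eq hG, SAW_weight_univ_eq hG,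
    ← ENNReal.ofReal_mul h1, ← ENNReal.ofReal_mul h3, ENNReal.ofReal_lt_ofReal_iff (by nlinarith)]
  linarith

/-- The non-strict form. [folklore] -/
theorem weight_mul_weight_le_of_posCert (a₁ b₁ a₂ b₂ a₃ b₃ a₄ b₄ : Site 2) {lo hi : ℚ} {d : ℕ}
    (hlo : (lo : ℝ) ≤ SAW.criticalFugacity) (hhi : SAW.criticalFugacity ≤ hi)
    (h : posCert (psub (pmul (sawPoly S a₃ b₃) (sawPoly S a₄ b₄)) (pmul (sawPoly S a₁ b₁) (sawPoly S a₂ b₂)))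
      d lo hi = true) :
    SAW.weight Ω δ a₁ b₁ Set.univ * SAW.weight Ω δ a₂ b₂ Set.univ ≤
      SAW.weight Ω δ a₃ b₃ Set.univ * SAW.weight Ω δ a₄ b₄ Set.univ :=
  (weight_mul_weight_lt_of_posCert hG a₁ b₁ a₂ b₂ a₃ b₃ a₄ b₄ hlo hhi h).le

/-! ### SAWs avoiding a set of sites (hull-avoidance events) -/

omit hG in
/-- The event that the SAW visits no site of `V` (given as integer pairs). [folklore] -/
def avoids (a b : Site 2) (V : List (ℤ × ℤ)) : Set (SAW.DomainSAW Ω δ a b) :=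
  {γ | ∀ x ∈ γ.walk.support, toPair x ∉ V}

omit hG in
/-- The length polynomial of the SAWs `a → b` of `ℤ²[S]` avoiding `V`. [folklore] -/
def sawPolyAvoiding (S V : List (ℤ × ℤ)) (a b : Site 2) : List ℚ :=
  ofNatList (sawHist S (toPair b) S.length (toPair a) V)

/-- SAWs avoiding `V` ↔ supports enumerated with the initial exclusion list `V` (for `a ∉ V`). [folklore] -/
theorem bijective_supportMap_avoiding (a b : Site 2) (V : List (ℤ × ℤ)) (ha : toPair a ∉ V) :
    Function.Bijective fun γ : ↥(avoids (Ω := Ω) (δ := δ) a b V) =>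
      (⟨γ.1.walk.support.map toPair, List.mem_toFinset.2 (map_support_mem_sawSupports hG b S.length γ.1.walk V
        γ.1.isPath (length_le_of_isPath hG γ.1.walk γ.1.isPath) γ.2)⟩ :
        ↥(sawSupports S (toPair b) S.length (toPair a) V).toFinset) := by
  constructor
  · intro γ γ' h
    have h1 : γ.1.walk.support.map toPair = γ'.1.walk.support.map toPair := congrArg Subtype.val h
    have h2 : γ.1.walk.support = γ'.1.walk.support := List.map_injective_iff.2 toPair_injective h1
    have h3 : γ.1.walk = γ'.1.walk := SimpleGraph.Walk.support_injective h2
    obtain ⟨⟨w, hw⟩, hγ⟩ := γ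
    obtain ⟨⟨w', hw'⟩, hγ'⟩ := γ'
    simp only at h3
    subst h3
    rfl
  · rintro ⟨s, hs⟩
    obtain ⟨p, hp, hsupp, hinv⟩ := exists_walk_of_mem_sawSupports hG b S.length a V s (List.mem_toFinset.1 hs)
    refine ⟨⟨⟨p, hp⟩, fun x hx => ?_⟩, Subtype.ext hsupp⟩
    rcases hinv x hx with rfl | h
    · exact ha
    · exact h

/-- **Length generating function of the SAWs avoiding `V`** (`a ∉ V`), at any fugacity `x ≥ 0`. [folklore] -/
theorem tsum_indicator_avoids_eq (a b : Site 2) (V : List (ℤ × ℤ)) (ha : toPair a ∉ V) {x : ℝ} (hx : 0 ≤ x) :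
    ∑' γ : SAW.DomainSAW Ω δ a b, (avoids a b V).indicator (fun γ => ENNReal.ofReal (x ^ γ.length)) γ =
      ENNReal.ofReal (peval (sawPolyAvoiding S V a b) x) := by
  classical
  set L := sawSupports S (toPair b) S.length (toPair a) V with hL
  let e : ↥(avoids (Ω := Ω) (δ := δ) a b V) ≃ ↥L.toFinset :=
    Equiv.ofBijective _ (bijective_supportMap_avoiding hG a b V ha)
  have hterm : ∀ γ : ↥(avoids (Ω := Ω) (δ := δ) a b V),
      ENNReal.ofReal (x ^ γ.1.length) = ENNReal.ofReal (x ^ ((e γ).1.length - 1)) := by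
    intro γ
    simp only [e, Equiv.ofBijective_apply, List.length_map, SimpleGraph.Walk.length_support, Nat.add_sub_cancel]
    rfl
  rw [← tsum_subtype (avoids a b V) fun γ => ENNReal.ofReal (x ^ γ.length)]
  calc ∑' γ : ↥(avoids (Ω := Ω) (δ := δ) a b V), ENNReal.ofReal (x ^ γ.1.length)
      = ∑' γ : ↥(avoids (Ω := Ω) (δ := δ) a b V), ENNReal.ofReal (x ^ ((e γ).1.length - 1)) := tsum_congr hterm
    _ = ∑' s : ↥L.toFinset, ENNReal.ofReal (x ^ (s.1.length - 1)) :=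
        e.tsum_eq (fun s : ↥L.toFinset => ENNReal.ofReal (x ^ (s.1.length - 1)))
    _ = ∑ s ∈ L.toFinset, ENNReal.ofReal (x ^ (s.length - 1)) := by
        rw [tsum_fintype]
        exact Finset.sum_coe_sort _ (fun s : List (ℤ × ℤ) => ENNReal.ofReal (x ^ (s.length - 1)))
    _ = (L.map fun s => ENNReal.ofReal (x ^ (s.length - 1))).sum :=
        List.sum_toFinset _ (nodup_sawSupports S (toPair b) S.length (toPair a) V)
    _ = ENNReal.ofReal (peval (sawPolyAvoiding S V a b) x) := by
        rw [list_sum_map_ofReal_pow hx, sawPolyAvoiding, peval_sawHist]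

/-- **Critical weight of a hull-avoidance event**: `SAW.weight Ω δ a b (avoids a b V) = ofReal (peval
(sawPolyAvoiding S V a b) x_c)` for `a ∉ V`. [cite: LawlerSchrammWerner2004SAW, §3.1 and §3.4.2] -/
theorem SAW_weight_avoids_eq (a b : Site 2) (V : List (ℤ × ℤ)) (ha : toPair a ∉ V) :
    SAW.weight Ω δ a b (avoids a b V) = ENNReal.ofReal (peval (sawPolyAvoiding S V a b) SAW.criticalFugacity) := by
  classical
  rw [SAW.weight, Measure.sum_apply _ MeasurableSpace.measurableSet_top,
    ← tsum_indicator_avoids_eq hG a b V ha SAW.criticalFugacity_pos_lt_one'.1.le]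
  refine tsum_congr fun γ => ?_
  rw [Measure.smul_apply, Measure.dirac_apply' _ MeasurableSpace.measurableSet_top, smul_eq_mul,
    Set.indicator_apply, Set.indicator_apply]
  split_ifs <;> simp

/-- **Certified strict product inequality for avoidance events** (FKG / TP₂ shapes with hull
avoidances): with `Pᵢ = sawPolyAvoiding S Vᵢ aᵢ bᵢ` and `aᵢ ∉ Vᵢ`, a sign certificate for
`P₃P₄ − P₁P₂` on `[lo, hi] ∋ x_c` gives
`w₁(avoids V₁) · w₂(avoids V₂) < w₃(avoids V₃) · w₄(avoids V₄)`. [folklore] -/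
theorem weight_avoids_mul_lt_of_posCert (a₁ b₁ a₂ b₂ a₃ b₃ a₄ b₄ : Site 2) (V₁ V₂ V₃ V₄ : List (ℤ × ℤ))
    (h₁ : toPair a₁ ∉ V₁) (h₂ : toPair a₂ ∉ V₂) (h₃ : toPair a₃ ∉ V₃) (h₄ : toPair a₄ ∉ V₄)
    {lo hi : ℚ} {d : ℕ} (hlo : (lo : ℝ) ≤ SAW.criticalFugacity) (hhi : SAW.criticalFugacity ≤ hi)
    (h : posCert (psub (pmul (sawPolyAvoiding S V₃ a₃ b₃) (sawPolyAvoiding S V₄ a₄ b₄))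
      (pmul (sawPolyAvoiding S V₁ a₁ b₁) (sawPolyAvoiding S V₂ a₂ b₂))) d lo hi = true) :
    SAW.weight Ω δ a₁ b₁ (avoids a₁ b₁ V₁) * SAW.weight Ω δ a₂ b₂ (avoids a₂ b₂ V₂) <
      SAW.weight Ω δ a₃ b₃ (avoids a₃ b₃ V₃) * SAW.weight Ω δ a₄ b₄ (avoids a₄ b₄ V₄) := by
  have hx := SAW.criticalFugacity_pos_lt_one'.1.le
  have hpos := posCert_sound h hlo hhi
  rw [peval_psub, peval_pmul, peval_pmul] at hpos
  have e1 : 0 ≤ peval (sawPolyAvoiding S V₁ a₁ b₁) SAW.criticalFugacity := peval_ofNatList_nonneg _ hx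
  have e2 : 0 ≤ peval (sawPolyAvoiding S V₂ a₂ b₂) SAW.criticalFugacity := peval_ofNatList_nonneg _ hx
  have e3 : 0 ≤ peval (sawPolyAvoiding S V₃ a₃ b₃) SAW.criticalFugacity := peval_ofNatList_nonneg _ hx
  rw [SAW_weight_avoids_eq hG a₁ b₁ V₁ h₁, SAW_weight_avoids_eq hG a₂ b₂ V₂ h₂, SAW_weight_avoids_eq hG a₃ b₃ V₃ h₃,
    SAW_weight_avoids_eq hG a₄ b₄ V₄ h₄, ← ENNReal.ofReal_mul e1, ← ENNReal.ofReal_mul e3,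
    ENNReal.ofReal_lt_ofReal_iff (by nlinarith)]
  linarith

omit hG in
/-- With nothing to avoid, the avoidance event is everything. [folklore] -/
@[simp] theorem avoids_nil (a b : Site 2) : avoids (Ω := Ω) (δ := δ) a b [] = Set.univ := by
  ext γ; simp [avoids]

end Domain

/-! ### Where `x_c` lies -/

/-- `x_c ∈ [1/3, 1/2]`, elementary (`2 ≤ μ(ℤ²) ≤ 3`). [cite: MadrasSlade1993, §1.2, eq. (1.2.2)] -/
theorem criticalFugacity_mem_Icc_third_half :
    (((1 : ℚ) / 3 : ℚ) : ℝ) ≤ SAW.criticalFugacity ∧ SAW.criticalFugacity ≤ (((1 : ℚ) / 2 : ℚ) : ℝ) := by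
  constructor
  · have h := SAW.one_third_le_criticalFugacity
    push_cast; linarith
  · have h := SAW.criticalFugacity_le_half
    push_cast; linarith

end Literature.Computation.FiniteGraph
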